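import Summits.Ventures.CertifiedQuantumChemistry.Rows.SpinFlipQuotient
import HarnessLib

/-!
# Ventures/CertifiedQuantumChemistry — Rows/SpinFlipQuotientLossless.lean: the `M = 0` spin-flip quotient
# is LOSSLESS at the DQG rung (convexity of the relaxation)

HONEST FRAMING (verbatim): certified bounds for a stated model Hamiltonian in a stated basis; not a
claim about the real molecule beyond that model.

Seat rdm-B (generator B `--flip`), ROWS courtesy file, companion of `Rows/SpinFlipQuotient.lean` (state
level: a bound on the `θ`-SYMMETRIC sector-feasible pairs is `≤ E(n, n)`). FORMAT-qcl1 §8c also states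
"LOSSLESS: the qcl1 relaxation is θ-invariant as a set with θ-invariant objective ⇒ it has a θ-symmetric
optimum (averaging), which is quotient-feasible ⇒ the two optima are EQUAL" — i.e. a dual bound certified
on a `qcl1f` (flip-quotient) instance is a bound of the FULL relaxation of the same rung, so the words
'DQG level' on such a row are exact. This file PROVES that sentence at the DQG rung, on the abstract pairs
`(γ, Γ) = (¹D, ²D)` of `Literature/…/VariationalRDMRelaxation.lean`, without speaking of optima (no
attainment is needed in bound form):

* §1 RELABELLING OF ABSTRACT PAIRS (any index bijection `e`; the pair is moved with Mathlib's
  `Matrix.submatrix`, no definition): the interconversion maps are EQUIVARIANT (`qMap_submatrix`,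
  `gMap_submatrix`) and DQG feasibility is INVARIANT (`isDQGFeasible_submatrix`).
* §2 CONVEXITY: the maps are affine (`qMap_midpoint`, `gMap_midpoint`) and the DQG / sector-DQG feasible
  sets are midpoint-convex (`isDQGFeasible_midpoint`, `isDQGFeasibleSector_midpoint`).
* §3 THE FLIP `θ = Orb.spinSwap`: sector feasibility at `(a, b)` goes to `(b, a)`
  (`isDQGFeasibleSector_spinSwap`); the energy functional of spin-free integrals is `θ`-invariant
  (`rdmEnergy_submatrix_spinSwap`) and affine (`rdmEnergy_midpoint`).
* §4 **LOSSLESS** — `exists_flipSymmetric_of_isDQGFeasibleSector`: every sector-DQG-feasible pair at `(n, n)`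
  has a `θ`-SYMMETRIC sector-DQG-feasible partner (its `θ`-average) with the SAME energy; hence
  **`forall_isDQGFeasibleSector_iff_forall_flipSymmetric`**: a real number lies below `Re E(γ, Γ)` on all
  sector-feasible pairs at `(n, n)` iff it does so on the `θ`-symmetric ones — the quotient programme and
  the full programme certify the same numbers.

Everything is PROVED (0 sorry, 0 def); nothing asserts a bound about any model; no claim node. The
`DQGT1T2′` rung (affinity / equivariance of `t1Map`, `t2Map`, `t2PrimeMap` of
`ThreeIndexRelaxationBound.lean`; same proof shape) is the companion file `Rows/SpinFlipQuotientLosslessT.lean`.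
References: FORMAT-qcl1 v0.3.0 §8c LOSSLESS (`HOME/pub-qchem-rdm/FORMAT-qcl1.md`; measured equal optima:
kit j112387, KL1-RESULTS §S0-H/§F); D. A. Mazziotti, Adv. Chem. Phys. 134 (2007) ch. 3 §II.E ("the convex
set of 2-RDMs from 2-positivity conditions"), §II.F; the general principle — a group-invariant semidefinite
programme has an invariant optimal solution by averaging — is C. Bachoc, D. C. Gijswijt, A. Schrijver,
F. Vallentin, *Invariant semidefinite programs* (2012) §1.2 ("so is its group average"; held copy
`paper:arxiv-1007.2905` p. 3).
-/

noncomputable section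

namespace Summit.Ventures.CertifiedQuantumChemistry

open Matrix Finset
open Literature.MathematicalPhysics.QuantumLattice Literature.MathematicalPhysics.QuantumChemistry
open scoped ComplexOrder

/-! ## §1 Relabelling an abstract pair along an index bijection -/

section Relabel

variable {ι : Type*} [LinearOrder ι] [Fintype ι] (e : ι ≃ ι)

omit [Fintype ι] in
/-- **The `Q`-map is equivariant** under a simultaneous relabelling of all indices. -/
theorem qMap_submatrix (γ : Matrix ι ι ℂ) (Γ : Matrix (ι × ι) (ι × ι) ℂ) :
    qMap (γ.submatrix e e) (Γ.submatrix (Prod.map e e) (Prod.map e e)) =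
      (qMap γ Γ).submatrix (Prod.map e e) (Prod.map e e) := by
  ext ⟨i, j⟩ ⟨k, l⟩
  simp [qMap, Matrix.submatrix_apply, EmbeddingLike.apply_eq_iff_eq]

omit [Fintype ι] in
/-- **The `G`-map is equivariant** under a simultaneous relabelling of all indices. -/
theorem gMap_submatrix (γ : Matrix ι ι ℂ) (Γ : Matrix (ι × ι) (ι × ι) ℂ) :
    gMap (γ.submatrix e e) (Γ.submatrix (Prod.map e e) (Prod.map e e)) =
      (gMap γ Γ).submatrix (Prod.map e e) (Prod.map e e) := by
  ext ⟨i, j⟩ ⟨k, l⟩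
  simp [gMap, Matrix.submatrix_apply, EmbeddingLike.apply_eq_iff_eq]

/-- **DQG feasibility is invariant under relabelling** (the feasible set of the programme is mapped to
itself by every index bijection: PSD cones by `PosSemidef.submatrix`, the rows by reindexing sums). -/
theorem isDQGFeasible_submatrix {N : ℕ} {γ : Matrix ι ι ℂ} {Γ : Matrix (ι × ι) (ι × ι) ℂ}
    (h : IsDQGFeasible N γ Γ) :
    IsDQGFeasible N (γ.submatrix e e) (Γ.submatrix (Prod.map e e) (Prod.map e e)) where
  herm_one := h.herm_one.submatrix e
  d_psd := h.d_psd.submatrix _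
  q_psd := by rw [qMap_submatrix]; exact h.q_psd.submatrix _
  g_psd := by rw [gMap_submatrix]; exact h.g_psd.submatrix _
  trace_one := by
    rw [← h.trace_one]
    exact Equiv.sum_comp e (fun i => γ i i)
  contract i k := by
    simp only [Matrix.submatrix_apply, Prod.map_apply]
    rw [← h.contract (e i) (e k)]
    exact Equiv.sum_comp e (fun j => Γ (e i, j) (e k, j))
  swap_fst i j q := by simpa [Matrix.submatrix_apply] using h.swap_fst (e i) (e j) (Prod.map e e q)
  swap_snd p k l := by simpa [Matrix.submatrix_apply] using h.swap_snd (Prod.map e e p) (e k) (e l)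

end Relabel

/-! ## §2 Convexity of the DQG feasible set -/

section Convex

variable {ι : Type*} [LinearOrder ι] [Fintype ι]

omit [Fintype ι] in
/-- The `Q`-map is affine: it commutes with midpoints. -/
theorem qMap_midpoint (γ γ' : Matrix ι ι ℂ) (Γ Γ' : Matrix (ι × ι) (ι × ι) ℂ) :
    qMap ((1 / 2 : ℂ) • (γ + γ')) ((1 / 2 : ℂ) • (Γ + Γ')) =
      (1 / 2 : ℂ) • (qMap γ Γ + qMap γ' Γ') := by
  ext ⟨i, j⟩ ⟨k, l⟩
  simp only [qMap, Matrix.smul_apply, Matrix.add_apply, smul_eq_mul]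
  ring

omit [Fintype ι] in
/-- The `G`-map is linear: it commutes with midpoints. -/
theorem gMap_midpoint (γ γ' : Matrix ι ι ℂ) (Γ Γ' : Matrix (ι × ι) (ι × ι) ℂ) :
    gMap ((1 / 2 : ℂ) • (γ + γ')) ((1 / 2 : ℂ) • (Γ + Γ')) =
      (1 / 2 : ℂ) • (gMap γ Γ + gMap γ' Γ') := by
  ext ⟨i, j⟩ ⟨k, l⟩
  simp only [gMap, Matrix.smul_apply, Matrix.add_apply, smul_eq_mul]
  split_ifs <;> ring

/-- A midpoint of positive semidefinite matrices is positive semidefinite. -/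
theorem posSemidef_midpoint {m : Type*} [Fintype m] {A B : Matrix m m ℂ} (hA : A.PosSemidef)
    (hB : B.PosSemidef) : ((1 / 2 : ℂ) • (A + B)).PosSemidef :=
  (hA.add hB).smul (by
    rw [show (1 / 2 : ℂ) = ((1 / 2 : ℝ) : ℂ) by norm_num]
    exact Complex.zero_le_real.2 (by norm_num))

/-- **The DQG feasible set is (midpoint-)convex** ("the convex set of 2-RDMs from 2-positivity
conditions", Mazziotti 2007 §II.E): cones and affine rows. -/
theorem isDQGFeasible_midpoint {N : ℕ} {γ γ' : Matrix ι ι ℂ} {Γ Γ' : Matrix (ι × ι) (ι × ι) ℂ}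
    (h : IsDQGFeasible N γ Γ) (h' : IsDQGFeasible N γ' Γ') :
    IsDQGFeasible N ((1 / 2 : ℂ) • (γ + γ')) ((1 / 2 : ℂ) • (Γ + Γ')) where
  herm_one := by
    have h2 : star (1 / 2 : ℂ) = 1 / 2 := by simp
    rw [Matrix.IsHermitian, conjTranspose_smul, h2, (h.herm_one.add h'.herm_one).eq]
  d_psd := posSemidef_midpoint h.d_psd h'.d_psd
  q_psd := by rw [qMap_midpoint]; exact posSemidef_midpoint h.q_psd h'.q_psd
  g_psd := by rw [gMap_midpoint]; exact posSemidef_midpoint h.g_psd h'.g_psd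
  trace_one := by
    simp only [Matrix.smul_apply, Matrix.add_apply, smul_eq_mul, ← Finset.mul_sum,
      Finset.sum_add_distrib, h.trace_one, h'.trace_one]
    ring
  contract i k := by
    simp only [Matrix.smul_apply, Matrix.add_apply, smul_eq_mul, ← Finset.mul_sum,
      Finset.sum_add_distrib, h.contract, h'.contract]
    ring
  swap_fst i j q := by
    simp only [Matrix.smul_apply, Matrix.add_apply, smul_eq_mul]
    rw [h.swap_fst i j q, h'.swap_fst i j q]
    ring
  swap_snd p k l := by
    simp only [Matrix.smul_apply, Matrix.add_apply, smul_eq_mul]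
    rw [h.swap_snd p k l, h'.swap_snd p k l]
    ring

end Convex

/-! ## §3 The flip on abstract pairs: sectors, energy -/

section Flip

variable {Λ : Type*} [LinearOrder Λ] [Fintype Λ]

/-- **Sector feasibility is `θ`-covariant**: the flipped pair of a sector-DQG-feasible pair at `(a, b)`
is sector-DQG-feasible at `(b, a)` (the `αα` / `ββ` traces trade places; the `αβ` trace is symmetric by
fermionic antisymmetry). In particular the balanced-sector feasible set is `θ`-invariant. -/
theorem isDQGFeasibleSector_spinSwap {a b : ℕ} {γ : Matrix (Orb Λ) (Orb Λ) ℂ}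
    {Γ : Matrix (Orb Λ × Orb Λ) (Orb Λ × Orb Λ) ℂ} (h : IsDQGFeasibleSector a b γ Γ) :
    IsDQGFeasibleSector b a (γ.submatrix Orb.spinSwap Orb.spinSwap)
      (Γ.submatrix (Prod.map Orb.spinSwap Orb.spinSwap) (Prod.map Orb.spinSwap Orb.spinSwap)) where
  dqg := by rw [add_comm]; exact isDQGFeasible_submatrix Orb.spinSwap h.dqg
  spin_sel p q σ τ hστ := by
    simp only [Matrix.submatrix_apply, Orb.spinSwap_orb]
    exact h.spin_sel p q _ _ fun h' => hστ ((Equiv.swap (0 : Fin 2) 1).injective h')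
  trace_up := by
    simp only [Matrix.submatrix_apply, Orb.spinSwap_orb, Equiv.swap_apply_left]
    exact h.trace_down
  trace_down := by
    simp only [Matrix.submatrix_apply, Orb.spinSwap_orb, Equiv.swap_apply_right]
    exact h.trace_up
  trace_upUp := by
    simp only [Matrix.submatrix_apply, Prod.map_apply, Orb.spinSwap_orb, Equiv.swap_apply_left]
    exact h.trace_downDown
  trace_downDown := by
    simp only [Matrix.submatrix_apply, Prod.map_apply, Orb.spinSwap_orb, Equiv.swap_apply_right]
    exact h.trace_upUp
  trace_upDown := by
    simp only [Matrix.submatrix_apply, Prod.map_apply, Orb.spinSwap_orb, Equiv.swap_apply_left,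
      Equiv.swap_apply_right]
    calc ∑ x : Λ, ∑ y : Λ, Γ (orb x 1, orb y 0) (orb x 1, orb y 0)
        = ∑ x : Λ, ∑ y : Λ, Γ (orb y 0, orb x 1) (orb y 0, orb x 1) := by
          refine Finset.sum_congr rfl fun x _ => Finset.sum_congr rfl fun y _ => ?_
          rw [h.dqg.swap_fst, h.dqg.swap_snd, neg_neg]
      _ = (b : ℂ) * (a : ℂ) := by rw [Finset.sum_comm, h.trace_upDown, mul_comm]

/-- **The sector-DQG feasible set is (midpoint-)convex.** -/
theorem isDQGFeasibleSector_midpoint {a b : ℕ} {γ γ' : Matrix (Orb Λ) (Orb Λ) ℂ}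
    {Γ Γ' : Matrix (Orb Λ × Orb Λ) (Orb Λ × Orb Λ) ℂ} (h : IsDQGFeasibleSector a b γ Γ)
    (h' : IsDQGFeasibleSector a b γ' Γ') :
    IsDQGFeasibleSector a b ((1 / 2 : ℂ) • (γ + γ')) ((1 / 2 : ℂ) • (Γ + Γ')) where
  dqg := isDQGFeasible_midpoint h.dqg h'.dqg
  spin_sel p q σ τ hστ := by
    simp only [Matrix.smul_apply, Matrix.add_apply, h.spin_sel p q σ τ hστ, h'.spin_sel p q σ τ hστ,
      add_zero, smul_zero]
  trace_up := by
    simp only [Matrix.smul_apply, Matrix.add_apply, smul_eq_mul, ← Finset.mul_sum,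
      Finset.sum_add_distrib, h.trace_up, h'.trace_up]
    ring
  trace_down := by
    simp only [Matrix.smul_apply, Matrix.add_apply, smul_eq_mul, ← Finset.mul_sum,
      Finset.sum_add_distrib, h.trace_down, h'.trace_down]
    ring
  trace_upUp := by
    simp only [Matrix.smul_apply, Matrix.add_apply, smul_eq_mul, ← Finset.mul_sum,
      Finset.sum_add_distrib, h.trace_upUp, h'.trace_upUp]
    ring
  trace_downDown := by
    simp only [Matrix.smul_apply, Matrix.add_apply, smul_eq_mul, ← Finset.mul_sum,
      Finset.sum_add_distrib, h.trace_downDown, h'.trace_downDown]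
    ring
  trace_upDown := by
    simp only [Matrix.smul_apply, Matrix.add_apply, smul_eq_mul, ← Finset.mul_sum,
      Finset.sum_add_distrib, h.trace_upDown, h'.trace_upDown]
    ring

omit [LinearOrder Λ] [Fintype Λ] in
/-- The spin sum of a `θ`-relabelled one-index pair is unchanged. -/
private theorem sum_spin_submatrix_spinSwap (γ : Matrix (Orb Λ) (Orb Λ) ℂ) (p q : Λ) :
    ∑ σ : Fin 2, γ.submatrix Orb.spinSwap Orb.spinSwap (orb p σ) (orb q σ) =
      ∑ σ : Fin 2, γ (orb p σ) (orb q σ) := by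
  simp only [Matrix.submatrix_apply, Orb.spinSwap_orb]
  exact Equiv.sum_comp (Equiv.swap (0 : Fin 2) 1) (fun σ => γ (orb p σ) (orb q σ))

omit [LinearOrder Λ] [Fintype Λ] in
/-- The double spin sum of a `θ`-relabelled two-index pair is unchanged. -/
private theorem sum_spin_spin_submatrix_spinSwap (Γ : Matrix (Orb Λ × Orb Λ) (Orb Λ × Orb Λ) ℂ)
    (p q r s : Λ) :
    ∑ σ : Fin 2, ∑ τ : Fin 2, Γ.submatrix (Prod.map Orb.spinSwap Orb.spinSwap)
        (Prod.map Orb.spinSwap Orb.spinSwap) (orb p σ, orb r τ) (orb q σ, orb s τ) =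
      ∑ σ : Fin 2, ∑ τ : Fin 2, Γ (orb p σ, orb r τ) (orb q σ, orb s τ) := by
  simp only [Matrix.submatrix_apply, Prod.map_apply, Orb.spinSwap_orb]
  calc ∑ σ : Fin 2, ∑ τ : Fin 2, Γ (orb p (Equiv.swap (0 : Fin 2) 1 σ), orb r (Equiv.swap (0 : Fin 2) 1 τ))
          (orb q (Equiv.swap (0 : Fin 2) 1 σ), orb s (Equiv.swap (0 : Fin 2) 1 τ))
      = ∑ σ : Fin 2, ∑ τ : Fin 2, Γ (orb p (Equiv.swap (0 : Fin 2) 1 σ), orb r τ)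
          (orb q (Equiv.swap (0 : Fin 2) 1 σ), orb s τ) :=
        Finset.sum_congr rfl fun σ _ => Equiv.sum_comp (Equiv.swap (0 : Fin 2) 1)
          (fun τ => Γ (orb p (Equiv.swap (0 : Fin 2) 1 σ), orb r τ)
            (orb q (Equiv.swap (0 : Fin 2) 1 σ), orb s τ))
    _ = ∑ σ : Fin 2, ∑ τ : Fin 2, Γ (orb p σ, orb r τ) (orb q σ, orb s τ) :=
        Equiv.sum_comp (Equiv.swap (0 : Fin 2) 1)
          (fun σ => ∑ τ : Fin 2, Γ (orb p σ, orb r τ) (orb q σ, orb s τ))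

omit [LinearOrder Λ] in
/-- **The energy functional of spin-free integrals is `θ`-invariant** on abstract pairs: it only sees
`Σ_σ γ^{pσ}_{qσ}` and `Σ_{στ} Γ^{pσ,rτ}_{qσ,sτ}`, sums over the spin label. -/
theorem rdmEnergy_submatrix_spinSwap (h : Λ → Λ → ℂ) (g : Λ → Λ → Λ → Λ → ℂ) (hnuc : ℂ)
    (γ : Matrix (Orb Λ) (Orb Λ) ℂ) (Γ : Matrix (Orb Λ × Orb Λ) (Orb Λ × Orb Λ) ℂ) :
    rdmEnergy h g hnuc (γ.submatrix Orb.spinSwap Orb.spinSwap)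
        (Γ.submatrix (Prod.map Orb.spinSwap Orb.spinSwap) (Prod.map Orb.spinSwap Orb.spinSwap)) =
      rdmEnergy h g hnuc γ Γ := by
  unfold rdmEnergy
  simp only [sum_spin_submatrix_spinSwap, sum_spin_spin_submatrix_spinSwap]

omit [LinearOrder Λ] in
/-- **The energy functional is affine**: it commutes with midpoints. -/
theorem rdmEnergy_midpoint (h : Λ → Λ → ℂ) (g : Λ → Λ → Λ → Λ → ℂ) (hnuc : ℂ)
    (γ γ' : Matrix (Orb Λ) (Orb Λ) ℂ) (Γ Γ' : Matrix (Orb Λ × Orb Λ) (Orb Λ × Orb Λ) ℂ) :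
    rdmEnergy h g hnuc ((1 / 2 : ℂ) • (γ + γ')) ((1 / 2 : ℂ) • (Γ + Γ')) =
      (1 / 2 : ℂ) * (rdmEnergy h g hnuc γ Γ + rdmEnergy h g hnuc γ' Γ') := by
  unfold rdmEnergy
  simp only [Matrix.smul_apply, Matrix.add_apply, smul_eq_mul, Finset.mul_sum, Finset.sum_add_distrib,
    mul_add]
  ring_nf

/-! ## §4 LOSSLESS: every feasible pair of the balanced sector has a `θ`-symmetric feasible partner of the
same energy -/

/-- **LOSSLESS (FORMAT-qcl1 §8c), DQG rung.** Every sector-DQG-feasible pair `(γ, Γ)` at `(n, n)` has a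
`θ`-SYMMETRIC sector-DQG-feasible partner with the same energy for every spin-free integral table — its
`θ`-average `(½(γ + θ·γ), ½(Γ + θ·Γ))` (feasible by `θ`-invariance and convexity of the feasible set). -/
theorem exists_flipSymmetric_of_isDQGFeasibleSector {n : ℕ} {γ : Matrix (Orb Λ) (Orb Λ) ℂ}
    {Γ : Matrix (Orb Λ × Orb Λ) (Orb Λ × Orb Λ) ℂ} (hγ : IsDQGFeasibleSector n n γ Γ) :
    ∃ (γ' : Matrix (Orb Λ) (Orb Λ) ℂ) (Γ' : Matrix (Orb Λ × Orb Λ) (Orb Λ × Orb Λ) ℂ),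
      IsDQGFeasibleSector n n γ' Γ' ∧
      (∀ i k, γ' (Orb.spinSwap i) (Orb.spinSwap k) = γ' i k) ∧
      (∀ i j k' l, Γ' (Orb.spinSwap i, Orb.spinSwap j) (Orb.spinSwap k', Orb.spinSwap l) =
        Γ' (i, j) (k', l)) ∧
      ∀ (h : Λ → Λ → ℂ) (g : Λ → Λ → Λ → Λ → ℂ) (hnuc : ℂ),
        rdmEnergy h g hnuc γ' Γ' = rdmEnergy h g hnuc γ Γ := by
  refine ⟨(1 / 2 : ℂ) • (γ + γ.submatrix Orb.spinSwap Orb.spinSwap),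
    (1 / 2 : ℂ) • (Γ + Γ.submatrix (Prod.map Orb.spinSwap Orb.spinSwap)
      (Prod.map Orb.spinSwap Orb.spinSwap)),
    isDQGFeasibleSector_midpoint hγ (isDQGFeasibleSector_spinSwap hγ), fun i k => ?_,
    fun i j k' l => ?_, fun h g hnuc => ?_⟩
  · simp only [Matrix.smul_apply, Matrix.add_apply, Matrix.submatrix_apply, spinSwap_spinSwap, add_comm]
  · simp only [Matrix.smul_apply, Matrix.add_apply, Matrix.submatrix_apply, Prod.map_apply,
      spinSwap_spinSwap, add_comm]
  · rw [rdmEnergy_midpoint, rdmEnergy_submatrix_spinSwap]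
    ring

/-- **The quotient and the full programme certify the same numbers** (FORMAT-qcl1 §8c "the two optima are
EQUAL", in bound form, DQG rung): a real number lies below the energy functional on ALL sector-DQG-feasible
pairs at `(n, n)` iff it lies below it on the `θ`-SYMMETRIC ones. -/
theorem forall_isDQGFeasibleSector_iff_forall_flipSymmetric (h : Λ → Λ → ℂ)
    (g : Λ → Λ → Λ → Λ → ℂ) (hnuc : ℂ) (n : ℕ) (c : ℝ) :
    (∀ γ Γ, IsDQGFeasibleSector n n γ Γ → c ≤ (rdmEnergy h g hnuc γ Γ).re) ↔
      ∀ γ Γ, IsDQGFeasibleSector n n γ Γ →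
        (∀ i k, γ (Orb.spinSwap i) (Orb.spinSwap k) = γ i k) →
        (∀ i j k' l, Γ ((Orb.spinSwap : Orb Λ ≃ Orb Λ) i, Orb.spinSwap j) (Orb.spinSwap k', Orb.spinSwap l) =
          Γ (i, j) (k', l)) →
        c ≤ (rdmEnergy h g hnuc γ Γ).re := by
  refine ⟨fun hc γ Γ hf _ _ => hc γ Γ hf, fun hc γ Γ hf => ?_⟩
  obtain ⟨γ', Γ', hf', hγ', hΓ', hE⟩ := exists_flipSymmetric_of_isDQGFeasibleSector hf
  rw [← hE h g hnuc]
  exact hc γ' Γ' hf' hγ' hΓ'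

end Flip

end Summit.Ventures.CertifiedQuantumChemistry

end
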